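import Summits.QuantumFields.BalabanUV.T4Continuum.Support.ScalarBlockTrialFunction

/-!
# T⁴ programme, spine node NE2 (U1a), tier B support row B4.c (iii), file 3b — THE COMPRESSIONS `Q′G′Q′*` AND `Q′G′²Q′*` OF THE
# `U = 1` SCALAR AVERAGED PROPAGATOR ARE COERCIVE ON THE UNIT LATTICE, UNIFORMLY IN `η`: `Q′G′Q′* ≥ σ₀`, `Q′G′²Q′* ≥ σ₀²`,
# `‖(Q′G′²Q′*)⁻¹‖ ≤ σ₀⁻²`, `σ₀ = (36^d·(4d + a′))⁻¹`

NE2 formalisation swarm `b2b-balaban-t4-ne2-formalise-*`, leaf 09, file 3b (support row B4.c, item (iii) «n₁»).  Row B4.b (leaf-05)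
factorises the gauge term of [Balaban1985BackgroundPropagators] (3.26) through the projection (3.25) p.394
«R = I − G′Q′*(Q′G′²Q′*)⁻¹Q′G′» and takes as its last `U = 1` datum a k-UNIFORM bound `n₁` on `‖N‖`, `N = (Q′G′²Q′*)⁻¹`.  With
files 1–2 (`ScalarBlockPoincare`, `ScalarAveragedPropagator`: `Π′ = n^dQ′ᴴQ′`, `Δ′ = Δ + a′Π′`, `G′ = Δ′⁻¹`), file 3a's trial
function `ψ_φ` (`ScalarBlockTrialFunction`), and Bałaban's weighted adjoint `Q′* = n^dQ′ᴴ`, this file proves it WITHOUT Fourier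
analysis:

 * §3 the VARIATIONAL BOUND **`variational`**: `2re⟨g, h⟩ − re⟨g, Δ′g⟩ ≤ re⟨h, G′h⟩` (`G′ = Δ′⁻¹ ≥ 0`), taken at `h = Q′ᴴφ`,
   `g = t·ψ_φ`, `t = β/((4d + a′)n^d)`: **`form_Scomp_ge`** `σ₀·nsq φ ≤ re⟨φ, Sφ⟩` for `Scomp := n^d•(Q′G′Q′ᴴ)` (= `Q′G′Q′*`),
   `σ₀ = sigma0 d a′ := (36^d(4d + a′))⁻¹`;
 * §4 `Kcomp := n^d•(Q′G′G′Q′ᴴ)` (= `Q′G′²Q′*`): `form_Kcomp_eq` (`⟨φ, Kφ⟩ = n^d·nsq (G′Q′ᴴφ)`), **`nsq_Scomp_le_form_Kcomp`**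
   (`nsq (Sφ) ≤ ⟨φ, Kφ⟩`, from `Π′ ≤ 1`), hence **`form_Kcomp_ge`** `σ₀²·nsq φ ≤ re⟨φ, Kφ⟩`, `Kcomp_posDef`, `isUnit_det_Kcomp`, and
   **`opNorm_Kcomp_inv_le`**: `‖K⁻¹‖ ≤ σ₀⁻²` — leaf-05's `n₁ = (36^d(4d + a′))²`, UNIFORM in `n = η⁻¹` and in the torus (crude but
   explicit in `d, a′`).

HONEST FRAMING (T4-DAG p. 1).  [folklore] finite-dimensional variational/positivity arguments about the cell's typed `U = 1` objects;
statements / constants OURS; nothing printed is a hypothesis.  `U = 1`, FIXED FINITE torus, scalar layer; a SUPPORT input of row B4.b,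
NOT B4, NOT [B9] (3.23)–(3.26) as printed; NE2 NOT proved; spine 0/9 unchanged; NOT infinite volume / mass gap / Clay / summit
progress.  HONEST DEPENDENCY: continuum YM on T⁴ ⇐ BetaPertH ∧ nine spine estimates (0/9 proved); BetaPertH ⇐ (D1) ∧ (D4) ∧ CAP+tail;
G-an2-4 gates asym, D1 and NE2/3/4.  ABSOLUTE RULE kept; zero sorries.
-/

noncomputable section

open scoped BigOperators ComplexConjugate ComplexOrder Matrix Matrix.Norms.L2Operator
open Finset

namespace Summit.QuantumFields.BalabanUV.T4Continuum.ScalarAveragedCompression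

open Literature.MathematicalPhysics.QuantumFieldTheory.Balaban1983to89.B5Prop11Plancherel
open Literature.MathematicalPhysics.QuantumFieldTheory.Balaban1983to89.B5Prop11Lower (nsq nsq_nonneg star_dotProduct_self
  norm_star_dotProduct_le)
open Literature.MathematicalPhysics.QuantumFieldTheory.Balaban1983to89.B5Action121 (sdiff LapS star_mulVec_dotProduct)
open Literature.MathematicalPhysics.QuantumFieldTheory.Balaban1983to89.B5Block118 (QsOp)
open Summit.QuantumFields.BalabanUV.T4Continuum.ScalarBlockPoincare
open Summit.QuantumFields.BalabanUV.T4Continuum.ScalarAveragedPropagator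
open Summit.QuantumFields.BalabanUV.T4Continuum.ScalarBlockTrialFunction

variable {d : ℕ}

/-! ## §3 The variational lower bound for `S = Q′G′Q′*` -/

section Variational

variable (n : ℕ) [NeZero n] (M : Fin d → ℕ) [hM : ∀ μ, NeZero (M μ)] {a' : ℝ}

/-- **the variational bound**: `2re⟨g, h⟩ − re⟨g, Δ′g⟩ ≤ re⟨h, G′h⟩` for all `g, h` (`G′ = Δ′⁻¹ ≥ 0`; expand
`0 ≤ ⟨h − Δ′g, G′(h − Δ′g)⟩`). [folklore] -/
theorem variational (ha' : 0 < a') (g h : Tor (fine n M) → ℂ) :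
    2 * (star g ⬝ᵥ h).re - (star g ⬝ᵥ (DeltaPs n M a' *ᵥ g)).re ≤ (star h ⬝ᵥ (Gps n M a' *ᵥ h)).re := by
  have hGpsd : (Gps n M a').PosSemidef := (DeltaPs_posDef n M ha').posSemidef.inv
  have hDG : Gps n M a' *ᵥ (DeltaPs n M a' *ᵥ g) = g := by
    rw [Matrix.mulVec_mulVec, Gps_mul_DeltaPs n M ha', Matrix.one_mulVec]
  set v := h - DeltaPs n M a' *ᵥ g with hv
  have h0 : 0 ≤ (star v ⬝ᵥ (Gps n M a' *ᵥ v)).re := by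
    have := hGpsd.dotProduct_mulVec_nonneg v
    exact (Complex.nonneg_iff.mp this).1
  -- expand the square
  have e : star v ⬝ᵥ (Gps n M a' *ᵥ v)
      = star h ⬝ᵥ (Gps n M a' *ᵥ h) - star h ⬝ᵥ g - star (DeltaPs n M a' *ᵥ g) ⬝ᵥ (Gps n M a' *ᵥ h)
        + star g ⬝ᵥ (DeltaPs n M a' *ᵥ g) := by
    rw [hv, Matrix.mulVec_sub, hDG, star_sub, sub_dotProduct, dotProduct_sub, dotProduct_sub]
    have e1 : star (DeltaPs n M a' *ᵥ g) ⬝ᵥ g = star g ⬝ᵥ (DeltaPs n M a' *ᵥ g) := by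
      rw [star_mulVec_dotProduct, (DeltaPs_isHermitian n M a').eq]
    rw [e1]; ring
  have e2 : star (DeltaPs n M a' *ᵥ g) ⬝ᵥ (Gps n M a' *ᵥ h) = star g ⬝ᵥ h := by
    rw [star_mulVec_dotProduct, (DeltaPs_isHermitian n M a').eq, Matrix.mulVec_mulVec, DeltaPs_mul_Gps n M ha', Matrix.one_mulVec]
  have e3 : (star h ⬝ᵥ g).re = (star g ⬝ᵥ h).re := by
    have e : star g ⬝ᵥ h = star (star h ⬝ᵥ g) := by rw [Matrix.star_dotProduct]
    rw [e, Complex.star_def, Complex.conj_re]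
  rw [e, e2] at h0
  simp only [Complex.sub_re, Complex.add_re] at h0
  linarith [e3]

/-- the unit-lattice compression `S = n^d•(Q′G′Q′ᴴ)` = `Q′G′Q′*` with Bałaban's `Q′* = n^dQ′ᴴ`. [folklore] -/
def Scomp (a' : ℝ) : Matrix (Tor M) (Tor M) ℂ := ((n : ℂ) ^ d) • (QsOp n M * Gps n M a' * (QsOp n M)ᴴ)

/-- and `K = n^d•(Q′G′G′Q′ᴴ)` = `Q′G′²Q′*`. [folklore] -/
def Kcomp (a' : ℝ) : Matrix (Tor M) (Tor M) ℂ := ((n : ℂ) ^ d) • (QsOp n M * Gps n M a' * Gps n M a' * (QsOp n M)ᴴ)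

/-- the uniform constant `σ₀ = (36^d·(4d + a′))⁻¹`. [folklore] -/
def sigma0 (d : ℕ) (a' : ℝ) : ℝ := ((36 : ℝ) ^ d * (4 * d + a'))⁻¹

omit hM in
/-- `0 < σ₀`. [folklore] -/
theorem sigma0_pos (ha' : 0 < a') : 0 < sigma0 d a' := by unfold sigma0; positivity

/-- `⟨φ, Sφ⟩ = n^d·⟨Q′ᴴφ, G′Q′ᴴφ⟩`. [folklore] -/
theorem form_Scomp (φ : Tor M → ℂ) :
    star φ ⬝ᵥ (Scomp n M a' *ᵥ φ) = ((n : ℂ) ^ d) * (star ((QsOp n M)ᴴ *ᵥ φ) ⬝ᵥ (Gps n M a' *ᵥ ((QsOp n M)ᴴ *ᵥ φ))) := by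
  rw [Scomp, Matrix.smul_mulVec, dotProduct_smul, smul_eq_mul, ← Matrix.mulVec_mulVec, ← Matrix.mulVec_mulVec]
  congr 1
  rw [star_mulVec_dotProduct, Matrix.conjTranspose_conjTranspose]

/-- **`S = Q′G′Q′*` IS COERCIVE, UNIFORMLY IN `η`**: `σ₀·nsq φ ≤ re⟨φ, Sφ⟩`, `σ₀ = (36^d(4d + a′))⁻¹`. [folklore] -/
theorem form_Scomp_ge (ha' : 0 < a') (φ : Tor M → ℂ) : sigma0 d a' * nsq φ ≤ (star φ ⬝ᵥ (Scomp n M a' *ᵥ φ)).re := by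
  have hn : (0 : ℝ) < (n : ℝ) ^ d := pow_pos (by exact_mod_cast Nat.pos_of_ne_zero (NeZero.ne n)) d
  set β : ℝ := (beta1 n) ^ d with hβ
  have hβ0 : 0 < β := pow_pos (beta1_ge n).2 d
  have hβ6 : (1 / 6 : ℝ) ^ d ≤ β := pow_le_pow_left₀ (by norm_num) (beta1_ge n).1 d
  set c : ℝ := (4 * d + a') * (n : ℝ) ^ d with hc
  have hc0 : 0 < c := by positivity
  set h := (QsOp n M)ᴴ *ᵥ φ with hh
  set ψ := trial n M φ with hψ
  -- `re⟨ψ, h⟩ = β·nsq φ`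
  have e1 : (star ψ ⬝ᵥ h).re = β * nsq φ := by
    rw [hh, ← star_mulVec_dotProduct, hψ, QsOp_trial, star_smul, smul_dotProduct, star_dotProduct_self, smul_eq_mul]
    rw [← hβ]
    simp [Complex.conj_ofReal]
  -- `re⟨ψ, Δ′ψ⟩ ≤ c·nsq φ`
  have e2 : (star ψ ⬝ᵥ (DeltaPs n M a' *ᵥ ψ)).re ≤ c * nsq φ := by
    rw [re_form_DeltaPs]
    have h1 := dirichlet_trial_le n M φ
    have h2 : nsq (PiS n M *ᵥ ψ) ≤ (n : ℝ) ^ d * nsq φ := (nsq_PiS_mulVec_le n M ψ).trans (nsq_trial_le n M φ)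
    rw [hc]; nlinarith [ha'.le]
  -- the variational bound at `g = t•ψ`, `t = β/c`
  set t : ℝ := β / c with ht
  have hv := variational n M ha' ((t : ℂ) • ψ) h
  have e3 : (star ((t : ℂ) • ψ) ⬝ᵥ h).re = t * (β * nsq φ) := by
    rw [star_smul, smul_dotProduct, smul_eq_mul, Complex.star_def, Complex.conj_ofReal, Complex.re_ofReal_mul, e1]
  have e4 : (star ((t : ℂ) • ψ) ⬝ᵥ (DeltaPs n M a' *ᵥ ((t : ℂ) • ψ))).re = t ^ 2 * (star ψ ⬝ᵥ (DeltaPs n M a' *ᵥ ψ)).re := by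
    rw [Matrix.mulVec_smul, star_smul, smul_dotProduct, dotProduct_smul, smul_eq_mul, smul_eq_mul, Complex.star_def,
      Complex.conj_ofReal, ← mul_assoc, ← Complex.ofReal_mul, Complex.re_ofReal_mul, sq]
  rw [e3, e4] at hv
  -- `⟨φ,Sφ⟩ = n^d ⟨h, G′h⟩`
  have e5 : (star φ ⬝ᵥ (Scomp n M a' *ᵥ φ)).re = (n : ℝ) ^ d * (star h ⬝ᵥ (Gps n M a' *ᵥ h)).re := by
    rw [form_Scomp, ← hh, ← Complex.ofReal_natCast, ← Complex.ofReal_pow, Complex.re_ofReal_mul]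
  rw [e5]
  have hda0 : (4 * (d : ℝ) + a') ≠ 0 := by positivity
  have hnd0 : ((n : ℝ) ^ d) ≠ 0 := hn.ne'
  have hcne : c ≠ 0 := hc0.ne'
  have k1 : 2 * (t * (β * nsq φ)) - t ^ 2 * (c * nsq φ) = β ^ 2 / c * nsq φ := by
    rw [ht]; field_simp; ring
  have k2 : (n : ℝ) ^ d * (β ^ 2 / c * nsq φ) = β ^ 2 / (4 * d + a') * nsq φ := by
    rw [hc, div_mul_eq_mul_div, div_mul_eq_mul_div, mul_div_assoc', div_eq_div_iff (mul_ne_zero hda0 hnd0) hda0]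
    ring
  have key : (n : ℝ) ^ d * (2 * (t * (β * nsq φ)) - t ^ 2 * (c * nsq φ)) = β ^ 2 / (4 * d + a') * nsq φ := by
    rw [k1, k2]
  have step : β ^ 2 / (4 * d + a') * nsq φ ≤ (n : ℝ) ^ d * (star h ⬝ᵥ (Gps n M a' *ᵥ h)).re := by
    rw [← key]
    refine mul_le_mul_of_nonneg_left ?_ hn.le
    have : t ^ 2 * (star ψ ⬝ᵥ (DeltaPs n M a' *ᵥ ψ)).re ≤ t ^ 2 * (c * nsq φ) := mul_le_mul_of_nonneg_left e2 (sq_nonneg t)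
    linarith
  refine le_trans ?_ step
  refine mul_le_mul_of_nonneg_right ?_ (nsq_nonneg φ)
  -- `σ₀ ≤ β²/(4d + a′)`
  have h36 : ((36 : ℝ) ^ d)⁻¹ = ((1 / 6 : ℝ) ^ d) ^ 2 := by
    rw [← inv_pow, ← pow_mul, mul_comm, pow_mul, show ((1 / 6 : ℝ)) ^ 2 = 36⁻¹ by norm_num]
  have hda : (0 : ℝ) < 4 * d + a' := by positivity
  unfold sigma0
  rw [mul_inv, h36, ← div_eq_mul_inv]
  exact div_le_div_of_nonneg_right (pow_le_pow_left₀ (by positivity) hβ6 2) hda.le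

end Variational

/-! ## §4 `K = Q′G′²Q′* ≥ S² ≥ σ₀²`, and `‖K⁻¹‖ ≤ σ₀⁻²` -/

section Kbound

variable (n : ℕ) [NeZero n] (M : Fin d → ℕ) [hM : ∀ μ, NeZero (M μ)] {a' : ℝ}

/-- `S` is Hermitian. [folklore] -/
theorem Scomp_isHermitian : (Scomp n M a').IsHermitian := by
  have hG := Gps_isHermitian n M a'
  unfold Matrix.IsHermitian Scomp
  rw [Matrix.conjTranspose_smul, Matrix.conjTranspose_mul, Matrix.conjTranspose_mul, Matrix.conjTranspose_conjTranspose, hG.eq,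
    ← Matrix.mul_assoc]
  congr 1
  rw [Complex.star_def, ← Complex.ofReal_natCast, ← Complex.ofReal_pow, Complex.conj_ofReal]

/-- `K` is Hermitian. [folklore] -/
theorem Kcomp_isHermitian : (Kcomp n M a').IsHermitian := by
  have hG := Gps_isHermitian n M a'
  unfold Matrix.IsHermitian Kcomp
  rw [Matrix.conjTranspose_smul, Matrix.conjTranspose_mul, Matrix.conjTranspose_mul, Matrix.conjTranspose_mul,
    Matrix.conjTranspose_conjTranspose, hG.eq, ← Matrix.mul_assoc, ← Matrix.mul_assoc]
  congr 1
  rw [Complex.star_def, ← Complex.ofReal_natCast, ← Complex.ofReal_pow, Complex.conj_ofReal]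

/-- `⟨φ, Kφ⟩ = n^d·nsq (G′Q′ᴴφ)` (a Gram form: real and nonnegative). [folklore] -/
theorem form_Kcomp_eq (φ : Tor M → ℂ) :
    star φ ⬝ᵥ (Kcomp n M a' *ᵥ φ) = (((n : ℝ) ^ d * nsq (Gps n M a' *ᵥ ((QsOp n M)ᴴ *ᵥ φ)) : ℝ) : ℂ) := by
  have hG := Gps_isHermitian n M a'
  set u := Gps n M a' *ᵥ ((QsOp n M)ᴴ *ᵥ φ) with hu
  rw [Kcomp, Matrix.smul_mulVec, dotProduct_smul, smul_eq_mul, ← Matrix.mulVec_mulVec, ← Matrix.mulVec_mulVec,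
    ← Matrix.mulVec_mulVec, ← hu]
  have e1 : star φ ⬝ᵥ (QsOp n M *ᵥ (Gps n M a' *ᵥ u)) = star ((QsOp n M)ᴴ *ᵥ φ) ⬝ᵥ (Gps n M a' *ᵥ u) := by
    rw [star_mulVec_dotProduct, Matrix.conjTranspose_conjTranspose]
  have e2 : star ((QsOp n M)ᴴ *ᵥ φ) ⬝ᵥ (Gps n M a' *ᵥ u) = star u ⬝ᵥ u := by
    conv_rhs => rw [hu, star_mulVec_dotProduct, hG.eq]
  rw [e1, e2, star_dotProduct_self]; push_cast; ring

/-- **`⟨φ, Kφ⟩ ≥ nsq (Sφ)`**: with `u = G′Q′ᴴφ`, `⟨φ,Kφ⟩ = n^d·nsq u` and `nsq (Sφ) = n^{2d}·nsq (Q′u) = n^d·nsq (Π′u) ≤ n^d·nsq u`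
(`Π′ ≤ 1`). [folklore] -/
theorem nsq_Scomp_le_form_Kcomp (φ : Tor M → ℂ) : nsq (Scomp n M a' *ᵥ φ) ≤ (star φ ⬝ᵥ (Kcomp n M a' *ᵥ φ)).re := by
  have hn : (0 : ℝ) ≤ (n : ℝ) ^ d := pow_nonneg (Nat.cast_nonneg _) d
  set u := Gps n M a' *ᵥ ((QsOp n M)ᴴ *ᵥ φ) with hu
  have e2 : Scomp n M a' *ᵥ φ = ((n : ℂ) ^ d) • (QsOp n M *ᵥ u) := by
    rw [Scomp, Matrix.smul_mulVec, ← Matrix.mulVec_mulVec, ← Matrix.mulVec_mulVec, ← hu]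
  have e3 : nsq (Scomp n M a' *ᵥ φ) = (n : ℝ) ^ d * nsq (PiS n M *ᵥ u) := by
    rw [e2, nsq_smul, norm_pow, Complex.norm_natCast, nsq_PiS_mulVec_eq]; ring
  rw [form_Kcomp_eq, e3, Complex.ofReal_re]
  exact mul_le_mul_of_nonneg_left (nsq_PiS_mulVec_le n M u) hn

/-- **`K = Q′G′²Q′*` IS COERCIVE, UNIFORMLY IN `η`**: `σ₀²·nsq φ ≤ re⟨φ, Kφ⟩`. [folklore] -/
theorem form_Kcomp_ge (ha' : 0 < a') (φ : Tor M → ℂ) : (sigma0 d a') ^ 2 * nsq φ ≤ (star φ ⬝ᵥ (Kcomp n M a' *ᵥ φ)).re := by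
  refine le_trans ?_ (nsq_Scomp_le_form_Kcomp n M φ)
  -- Cauchy–Schwarz: `σ₀ nsq φ ≤ re⟨φ,Sφ⟩ ≤ √nsq φ · √nsq(Sφ)`
  have h1 : sigma0 d a' * nsq φ ≤ Real.sqrt (nsq φ) * Real.sqrt (nsq (Scomp n M a' *ᵥ φ)) :=
    (form_Scomp_ge n M ha' φ).trans (re_star_dotProduct_le _ _)
  have hsφ : Real.sqrt (nsq φ) ^ 2 = nsq φ := Real.sq_sqrt (nsq_nonneg _)
  have hsS : Real.sqrt (nsq (Scomp n M a' *ᵥ φ)) ^ 2 = nsq (Scomp n M a' *ᵥ φ) := Real.sq_sqrt (nsq_nonneg _)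
  by_cases hz : nsq φ = 0
  · rw [hz, mul_zero]; exact nsq_nonneg _
  · have hpos : 0 < nsq φ := lt_of_le_of_ne (nsq_nonneg _) (Ne.symm hz)
    have hsq0 : 0 < Real.sqrt (nsq φ) := Real.sqrt_pos.mpr hpos
    have h2 : sigma0 d a' * Real.sqrt (nsq φ) ≤ Real.sqrt (nsq (Scomp n M a' *ᵥ φ)) := by
      have h3 : sigma0 d a' * Real.sqrt (nsq φ) * Real.sqrt (nsq φ) ≤ Real.sqrt (nsq (Scomp n M a' *ᵥ φ)) * Real.sqrt (nsq φ) := by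
        rw [mul_assoc, ← sq, hsφ, mul_comm (Real.sqrt _)]; exact h1
      exact le_of_mul_le_mul_right h3 hsq0
    calc sigma0 d a' ^ 2 * nsq φ = (sigma0 d a' * Real.sqrt (nsq φ)) ^ 2 := by rw [mul_pow, hsφ]
      _ ≤ Real.sqrt (nsq (Scomp n M a' *ᵥ φ)) ^ 2 :=
          pow_le_pow_left₀ (mul_nonneg (sigma0_pos (d := d) ha').le (Real.sqrt_nonneg _)) h2 2
      _ = nsq (Scomp n M a' *ᵥ φ) := hsS

/-- `K` is positive definite. [folklore] -/
theorem Kcomp_posDef (ha' : 0 < a') : (Kcomp n M a').PosDef := by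
  refine Matrix.PosDef.of_dotProduct_mulVec_pos (Kcomp_isHermitian n M) fun x hx => ?_
  have hσ := sigma0_pos (d := d) ha'
  have hre := form_Kcomp_ge n M ha' x
  have hx' : 0 < nsq x := by
    obtain ⟨i, hi⟩ := Function.ne_iff.mp hx
    exact lt_of_lt_of_le (pow_pos (norm_pos_iff.mpr hi) 2)
      (Finset.single_le_sum (f := fun j => ‖x j‖ ^ 2) (fun j _ => sq_nonneg _) (Finset.mem_univ i))
  rw [form_Kcomp_eq] at hre ⊢
  rw [Complex.ofReal_re] at hre
  rw [Complex.zero_lt_real]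
  nlinarith [pow_pos hσ 2]

/-- `K` is invertible. [folklore] -/
theorem isUnit_det_Kcomp (ha' : 0 < a') : IsUnit (Kcomp n M a').det :=
  (Matrix.isUnit_iff_isUnit_det _).mp (Kcomp_posDef n M ha').isUnit

/-- **`‖K⁻¹‖ ≤ σ₀⁻²` — leaf-05's `n₁`, UNIFORM in `η = 1/n` and in the torus.** [folklore] -/
theorem opNorm_Kcomp_inv_le (ha' : 0 < a') : ‖(Kcomp n M a')⁻¹‖ ≤ ((sigma0 d a') ^ 2)⁻¹ := by
  have hσ := sigma0_pos (d := d) ha'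
  have hσ2 : 0 < sigma0 d a' ^ 2 := pow_pos hσ 2
  refine opNorm_le_of_nsq_le_rect _ (inv_nonneg.mpr hσ2.le) fun y => ?_
  set x := (Kcomp n M a')⁻¹ *ᵥ y with hx
  have hKx : Kcomp n M a' *ᵥ x = y := by
    rw [hx, Matrix.mulVec_mulVec, Matrix.mul_nonsing_inv _ (isUnit_det_Kcomp n M ha'), Matrix.one_mulVec]
  have h1 : sigma0 d a' ^ 2 * nsq x ≤ (star x ⬝ᵥ y).re := by
    have h := form_Kcomp_ge n M ha' x
    rwa [hKx] at h
  have h2 : (star x ⬝ᵥ y).re ≤ Real.sqrt (nsq x) * Real.sqrt (nsq y) := re_star_dotProduct_le x y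
  have hsx : Real.sqrt (nsq x) ^ 2 = nsq x := Real.sq_sqrt (nsq_nonneg _)
  have hsy : Real.sqrt (nsq y) ^ 2 = nsq y := Real.sq_sqrt (nsq_nonneg _)
  have h3 : sigma0 d a' ^ 2 * Real.sqrt (nsq x) ≤ Real.sqrt (nsq y) := by
    by_cases hz : Real.sqrt (nsq x) = 0
    · rw [hz, mul_zero]; exact Real.sqrt_nonneg _
    · have hpos : 0 < Real.sqrt (nsq x) := lt_of_le_of_ne (Real.sqrt_nonneg _) (Ne.symm hz)
      have h4 : sigma0 d a' ^ 2 * Real.sqrt (nsq x) * Real.sqrt (nsq x) ≤ Real.sqrt (nsq y) * Real.sqrt (nsq x) := by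
        nlinarith [h1, h2, hsx]
      exact le_of_mul_le_mul_right h4 hpos
  have h5 : Real.sqrt (nsq x) ≤ (sigma0 d a' ^ 2)⁻¹ * Real.sqrt (nsq y) := by
    rw [← div_eq_inv_mul, le_div_iff₀ hσ2]; linarith
  calc nsq x = Real.sqrt (nsq x) ^ 2 := hsx.symm
    _ ≤ ((sigma0 d a' ^ 2)⁻¹ * Real.sqrt (nsq y)) ^ 2 := pow_le_pow_left₀ (Real.sqrt_nonneg _) h5 2
    _ = ((sigma0 d a' ^ 2)⁻¹) ^ 2 * nsq y := by rw [mul_pow, hsy]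

/-! ### The isometric normalisation `Q̃′ = √(n^d)·Q′` (`‖Q̃′‖ ≤ 1`): `S = Q̃′G′Q̃′ᴴ`, `K = Q̃′G′²Q̃′ᴴ`

Row B4.b's abstract numbers are stated for a contraction `Q′` with standard adjoints; the projection
`G′Q′ᴴ(Q′G′²Q′ᴴ)⁻¹Q′G′` is invariant under `Q′ ↦ c•Q′`, and with `Q̃′` the compressions above are literally `Scomp`/`Kcomp`. -/

/-- the isometrically normalised scalar block averaging `Q̃′ = √(n^d)·Q′`. [folklore] -/
def Qiso : Matrix (Tor M) (Tor (fine n M)) ℂ := (((Real.sqrt ((n : ℝ) ^ d)) : ℝ) : ℂ) • QsOp n M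

/-- `‖Q̃′‖ ≤ 1` (block Cauchy–Schwarz `nsq (Q′g) ≤ n^{−d}·nsq g`). [folklore] -/
theorem opNorm_Qiso_le : ‖Qiso n M‖ ≤ 1 := by
  have hn : (0 : ℝ) < (n : ℝ) ^ d := pow_pos (by exact_mod_cast Nat.pos_of_ne_zero (NeZero.ne n)) d
  refine opNorm_le_of_nsq_le_rect _ zero_le_one fun g => ?_
  rw [Qiso, Matrix.smul_mulVec, nsq_smul, Complex.norm_real, Real.norm_of_nonneg (Real.sqrt_nonneg _),
    Real.sq_sqrt hn.le, one_pow, one_mul]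
  calc (n : ℝ) ^ d * nsq (QsOp n M *ᵥ g) ≤ (n : ℝ) ^ d * (((n : ℝ) ^ d)⁻¹ * nsq g) :=
        mul_le_mul_of_nonneg_left (nsq_QsOp_mulVec_le n M g) hn.le
    _ = nsq g := by field_simp

/-- `S = Q̃′G′Q̃′ᴴ`. [folklore] -/
theorem Scomp_eq_iso : Scomp n M a' = Qiso n M * Gps n M a' * (Qiso n M)ᴴ := by
  have hs : star ((((Real.sqrt ((n : ℝ) ^ d)) : ℝ) : ℂ)) = (((Real.sqrt ((n : ℝ) ^ d)) : ℝ) : ℂ) := Complex.conj_ofReal _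
  have hss : ((((Real.sqrt ((n : ℝ) ^ d)) : ℝ) : ℂ)) * (((Real.sqrt ((n : ℝ) ^ d)) : ℝ) : ℂ) = (n : ℂ) ^ d := by
    rw [← Complex.ofReal_mul, Real.mul_self_sqrt (pow_nonneg (Nat.cast_nonneg _) d)]; push_cast; rfl
  rw [Qiso, Matrix.conjTranspose_smul, hs, Matrix.smul_mul, Matrix.smul_mul, Matrix.mul_smul, smul_smul, hss, Scomp]

/-- `K = Q̃′G′G′Q̃′ᴴ = (Q̃′G′)(Q̃′G′)ᴴ`. [folklore] -/
theorem Kcomp_eq_iso : Kcomp n M a' = Qiso n M * Gps n M a' * Gps n M a' * (Qiso n M)ᴴ ∧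
    Kcomp n M a' = (Qiso n M * Gps n M a') * (Qiso n M * Gps n M a')ᴴ := by
  have hs : star ((((Real.sqrt ((n : ℝ) ^ d)) : ℝ) : ℂ)) = (((Real.sqrt ((n : ℝ) ^ d)) : ℝ) : ℂ) := Complex.conj_ofReal _
  have hss : ((((Real.sqrt ((n : ℝ) ^ d)) : ℝ) : ℂ)) * (((Real.sqrt ((n : ℝ) ^ d)) : ℝ) : ℂ) = (n : ℂ) ^ d := by
    rw [← Complex.ofReal_mul, Real.mul_self_sqrt (pow_nonneg (Nat.cast_nonneg _) d)]; push_cast; rfl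
  have h1 : Kcomp n M a' = Qiso n M * Gps n M a' * Gps n M a' * (Qiso n M)ᴴ := by
    rw [Qiso, Matrix.conjTranspose_smul, hs, Matrix.smul_mul, Matrix.smul_mul, Matrix.smul_mul, Matrix.mul_smul, smul_smul, hss,
      Kcomp]
  refine ⟨h1, ?_⟩
  rw [h1, Matrix.conjTranspose_mul, (Gps_isHermitian n M a').eq]
  simp only [Matrix.mul_assoc]

end Kbound

end Summit.QuantumFields.BalabanUV.T4Continuum.ScalarAveragedCompression

end
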